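import Summits.Ventures.CertifiedManyBodySolver.Observables.StiffnessApexTransportCurtain
import HarnessLib

/-!
# Ventures/CertifiedManyBodySolver — Observables/StiffnessApexTransportCurtainTop.lean

HONEST FRAMING: one-sided certified CEILINGS on the uniform flux stiffness (`t–t′` f-sum class) at half filling, transported into a `(t′, U)`
box from a «curtain» of sources; a ceiling never speaks to the presence of order; not a `T_c` estimate, not a superconductivity verdict; every
leaf is CONDITIONAL on the row families it names. Zero compute, no definition, no claim node, no `sorry`.

Cell `pub/hubbard-downfold` (D-0154 (1)(C) COVERAGE, La214 «74/5 insurance»), seat `hubbard-cov-la214-unc-2` (`prover-hubbard-cov-la214-unc-2-0`);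
companion of `Observables/StiffnessApexTransportCurtain.lean` (seat hubbard-downfold-unc-2 g15: slot engine, curtain master = bottom inner segment +
left edge `[U_A, U_L]` + corner-objective overhang AT `U_L`; editions (E1) one station + long overhang, (E2) the «L», (E3) the hybrid).

THE OTHER CURTAIN. The curtain master puts the left-edge words at the BOTTOM of the left edge and the overhang at the TOP station `U_L`. Here the
window is at the TOP: station `U_A` with its inner own words `[p, q] × {U_A}` and a SHORT corner-objective overhang `[p(2 − U_A/U_L), p] × {U_A}`
(enough for every target up to the height `U_L`), plus own words on the TOP of the left edge `{p} × [U_L, U_max]`. This words the WHOLE box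
`[p, q] × [U_A, U_max]`: a target ABOVE `U_L` whose `U_A`-source misses the short overhang crosses the line `t′ = p` at the height `U′ = U(2 − p/t′) ≥ U_L`
(§1, the one inequality of this file), i.e. inside the top window, where the left-edge point's own word serves it (slot `p ≤ t′`). The general statement
(§2) is the TWO-WINDOW curtain — left edge on `[U_A, U_L₁]`, corner-objective overhang at `U_L₁` reaching `p(2 − U_L₁/U_L₂)`, left edge on `[U_L₂, U_max]` —
whose four corners are (E1) (`U_L₁ = U_A`, `U_L₂ = U_max`), (E2) (`U_L₁ = U_L₂`), (E3) (`U_L₂ = U_max`) and the new edition (E6) (`U_L₁ = U_A`, §3).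

WHY (the «74/5 insurance» of director-hubbard R18, La214-E `[−3/10, −1/5] × [29/5, 74/5]`): under (E1) the overhang of the one station `29/5` reaches
`−357/740 ≈ −0.4824` and its far vertex serves only the top-left corner `(−3/10, 74/5)`; under (E6) with `U_L = 8` the overhang reaches only
`−153/400 = −0.3825` and the top slab is served by a `U`-segment family on `{−3/10} × [8, 74/5]` whose two vertices are the insurance parents
`(8, −3/10)` and `(74/5, −3/10)` (§5). Planning arithmetic [float, not of record]: every source of (E6) is asked for a word of kinematic scale
`≤ k(−3/10) = 0.4392` (bar `0.4364687`); the binding point is the corner `(−3/10, 29/5)` as in every edition; the `U`-segment family sits where own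
words are smallest (`U ≥ 8`).

* §1 `leftEdge_height_gt_of_apexSource_lt_shortOverhang` — the geometry: missing the short overhang `p(2 − U_S/U_L)` at the station `U_S` forces the
  left-edge crossing above `U_L` (for targets at height `U ≥ U_L`);
* §2 MASTER `ObsStiffnessSeqCeilingAt_halfFilling_on_box_of_twoWindowCurtain_orbitLower`;
* §3 EDITION (E6) `ObsStiffnessSeqCeilingAt_halfFilling_on_box_of_apexStation_shortOverhang_and_leftEdgeTop` (family form) and §4 its CHORD form
  (three two-vertex bundles, six vertex constants, FOUR distinct vertices: `(p(2 − U_A/U_L), U_A)`, `(p, U_A)` [own word = corner objective, serves the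
  inner AND the overhang bundle], `(q, U_A)`, `(p, U_L)`, `(p, U_max)`);
* §5 «La214-E» instances: generic `U_L ∈ [29/5, 74/5]` and the literal editions `U_L = 8` (overhang `−153/400`), `U_L = 11` (`−243/550`),
  `U_L = 6` (`−31/100`).

NOT said: nothing flows toward smaller `U`; a LEAF transports nowhere — only ROWS do; no `T > 0`, no `λ ≠ 0`, no doped box (the priced / target-slot
editions of the companions carry over verbatim but are not restated); no number.

References: T. Koma, H. Tasaki, J. Stat. Phys. 76 (1994) 745, §1 [KomaTasaki1994]; D. J. Scalapino, S. R. White, S.-C. Zhang, PRB 47 (1993)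
7995, §II [ScalapinoWhiteZhang1993].
-/

noncomputable section

namespace Summit.Ventures.CertifiedManyBodySolver.Observables

open Literature.MathematicalPhysics.QuantumLattice
open Literature.MathematicalPhysics.QuantumLattice.ThermodynamicLimit
open Literature.MathematicalPhysics.QuantumFieldTheory
open Literature.Probability.LatticeModels
open Matrix Finset Filter Topology HubbardWave0
open scoped Matrix BigOperators ComplexOrder

/-! ## §1 Geometry: missing a SHORT overhang forces the left-edge crossing into the top window -/

/-- **Missing the short overhang ⇒ crossing the left edge above `U_L`.** Target `(t′, U)` with `p ≤ t′ < 0`, a station `0 < U_S ≤ U_L ≤ U`. If the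
target's source parameter at the station, `t′(2U − U_S)/U`, lies LEFT of the short overhang end `p(2 − U_S/U_L)`, then the apex segment of the target
crosses the line `t′ = p` strictly above `U_L`: `U_L < U(2 − p/t′)`. (Identity: `(pU − t′(2U − U_L))(2U_L − U_S) =
[pU(2U_L − U_S) − t′(2U − U_S)U_L] − 2t′(U_L − U_S)(U − U_L)`, both brackets `≥ 0`, the first `> 0`.) [folklore] -/
theorem leftEdge_height_gt_of_apexSource_lt_shortOverhang {p tp US UL U : ℝ} (ht0 : tp < 0) (hS : 0 < US) (hSL : US ≤ UL)
    (hLU : UL ≤ U) (hmiss : tp * (2 * U - US) / U < p * (2 - US / UL)) : UL < U * (2 - p / tp) := by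
  have hL : 0 < UL := hS.trans_le hSL
  have hU : 0 < U := hL.trans_le hLU
  rw [← apexSource_lt_iff_station_lt_leftEdge ht0 hU, div_lt_iff₀ hU]
  -- clear denominators in the hypothesis
  have h1 : tp * (2 * U - US) < p * (2 - US / UL) * U := (div_lt_iff₀ hU).1 hmiss
  have h2 : tp * (2 * U - US) * UL < p * (2 - US / UL) * U * UL := mul_lt_mul_of_pos_right h1 hL
  have e2 : p * (2 - US / UL) * U * UL = p * (2 * UL - US) * U := by
    field_simp
  rw [e2] at h2
  have key : (p * U - tp * (2 * U - UL)) * (2 * UL - US) =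
      (p * (2 * UL - US) * U - tp * (2 * U - US) * UL) - 2 * tp * (UL - US) * (U - UL) := by ring
  have hnn : 0 ≤ -(2 * tp * (UL - US) * (U - UL)) := by
    have : 0 ≤ 2 * (-tp) * (UL - US) * (U - UL) :=
      mul_nonneg (mul_nonneg (mul_nonneg (by norm_num) (by linarith)) (by linarith)) (by linarith)
    linarith
  have hpos : 0 < (p * U - tp * (2 * U - UL)) * (2 * UL - US) := by
    rw [key]; linarith
  have h2L : 0 < 2 * UL - US := by linarith
  have hgoal : 0 < p * U - tp * (2 * U - UL) := (mul_pos_iff_of_pos_right h2L).1 hpos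
  linarith

/-! ## §2 MASTER THEOREM: the TWO-WINDOW curtain (left edge `[U_A, U_L₁]`, overhang at `U_L₁` to `p(2 − U_L₁/U_L₂)`, left edge `[U_L₂, U_max]`) -/

section TwoWindow

variable {UA UL₁ UL₂ Umax p q : ℝ}

/-- **THE TWO-WINDOW CURTAIN (half filling).** Box `[p, q] × [U_A, U_max]`, `q ≤ 0 < U_A ≤ U_L₁ ≤ U_L₂` (`U_L₂ ≤ U_max` intended; not needed).
Four unconditional orbit-lower families for the `λ = 0` f-sum word on torus-limit ground-state classes at density `1`:
(BOTTOM) `valB s ≤` orbit mean of `−X₀(s)` on the class at `(s, U_A)`, `s ∈ [p, q]` — own words;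
(LEFT₁) `valL₁ U' ≤` orbit mean of `−X₀(p)` on the class at `(p, U')`, `U' ∈ [U_A, U_L₁]` — own words on the lower window of the left edge;
(OVERHANG at `U_L₁`) `valO s ≤` orbit mean of `−X₀(p)` (the CORNER objective) on the class at `(s, U_L₁)`, `s ∈ [p(2 − U_L₁/U_L₂), p]` — a SHORT overhang,
enough for the targets below `U_L₂`;
(LEFT₂) `valL₂ U' ≤` orbit mean of `−X₀(p)` on the class at `(p, U')`, `U' ∈ [U_L₂, U_max]` — own words on the upper window of the left edge;
all with `−val ≤ c` on their domains. Then `ObsStiffnessSeqCeilingAt t′ U 1 c` at EVERY point of the box. Proof: below `U_L₂` this is the curtain master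
with `U_max := U_L₂`; a target above `U_L₂` is followed down its apex segment — bottom source `s_A ≥ p`, else left-edge crossing `U' = U(2 − p/t′)`: in the
lower window ⇒ LEFT₁; at or above `U_L₂` ⇒ LEFT₂; strictly between ⇒ the segment passes the height `U_L₁` inside the short overhang (§1 contraposed) ⇒ OVERHANG.
Corners: `U_L₁ = U_A, U_L₂ = U_max` = (E1); `U_L₁ = U_L₂` = (E2); `U_L₂ = U_max` = (E3)/the curtain master; `U_L₁ = U_A` = (E6) of §3.
[cite: KomaTasaki1994, §1] [cite: ScalapinoWhiteZhang1993, §II] -/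
theorem ObsStiffnessSeqCeilingAt_halfFilling_on_box_of_twoWindowCurtain_orbitLower (hUA : 0 < UA) (hA1 : UA ≤ UL₁) (h12 : UL₁ ≤ UL₂)
    (hq : q ≤ 0) (valB valL₁ valO valL₂ : ℝ → ℝ) (c : ℚ)
    (hB : ∀ s ∈ Set.Icc p q,
      ∀ (ω : InfVolFermionState 2) (Ls : ℕ → ℕ) (ψ : ∀ L, Fock (Orb (FermionTorus 2 L))),
      Tendsto Ls atTop atTop →
      (∀ j, IsGroundStateInSector (hubbardTorusTT' (Ls j) 1 s UA) (rectN 1 (Ls j)) 0 (ψ (Ls j))) →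
      (∀ j, star (ψ (Ls j)) ⬝ᵥ ψ (Ls j) = 1) → ω.IsTorusLimitOf ψ Ls →
      valB s ≤ ((Finset.univ : Finset (DihedralGroup 4)).card : ℝ)⁻¹ * ∑ g ∈ (Finset.univ : Finset (DihedralGroup 4)),
        (ω.expect (d4ShiftSet g 0 (box 2 7)) (fermionEmbed (PolySite.d4Emb g 0 (box 2 7)) (-oddMomentObsTT s UA 0))).re)
    (hcB : ∀ s ∈ Set.Icc p q, -valB s ≤ ((c : ℚ) : ℝ))
    (hL₁ : ∀ U' ∈ Set.Icc UA UL₁,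
      ∀ (ω : InfVolFermionState 2) (Ls : ℕ → ℕ) (ψ : ∀ L, Fock (Orb (FermionTorus 2 L))),
      Tendsto Ls atTop atTop →
      (∀ j, IsGroundStateInSector (hubbardTorusTT' (Ls j) 1 p U') (rectN 1 (Ls j)) 0 (ψ (Ls j))) →
      (∀ j, star (ψ (Ls j)) ⬝ᵥ ψ (Ls j) = 1) → ω.IsTorusLimitOf ψ Ls →
      valL₁ U' ≤ ((Finset.univ : Finset (DihedralGroup 4)).card : ℝ)⁻¹ * ∑ g ∈ (Finset.univ : Finset (DihedralGroup 4)),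
        (ω.expect (d4ShiftSet g 0 (box 2 7)) (fermionEmbed (PolySite.d4Emb g 0 (box 2 7)) (-oddMomentObsTT p U' 0))).re)
    (hcL₁ : ∀ U' ∈ Set.Icc UA UL₁, -valL₁ U' ≤ ((c : ℚ) : ℝ))
    (hO : ∀ s ∈ Set.Icc (p * (2 - UL₁ / UL₂)) p,
      ∀ (ω : InfVolFermionState 2) (Ls : ℕ → ℕ) (ψ : ∀ L, Fock (Orb (FermionTorus 2 L))),
      Tendsto Ls atTop atTop →
      (∀ j, IsGroundStateInSector (hubbardTorusTT' (Ls j) 1 s UL₁) (rectN 1 (Ls j)) 0 (ψ (Ls j))) →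
      (∀ j, star (ψ (Ls j)) ⬝ᵥ ψ (Ls j) = 1) → ω.IsTorusLimitOf ψ Ls →
      valO s ≤ ((Finset.univ : Finset (DihedralGroup 4)).card : ℝ)⁻¹ * ∑ g ∈ (Finset.univ : Finset (DihedralGroup 4)),
        (ω.expect (d4ShiftSet g 0 (box 2 7)) (fermionEmbed (PolySite.d4Emb g 0 (box 2 7)) (-oddMomentObsTT p UL₁ 0))).re)
    (hcO : ∀ s ∈ Set.Icc (p * (2 - UL₁ / UL₂)) p, -valO s ≤ ((c : ℚ) : ℝ))
    (hL₂ : ∀ U' ∈ Set.Icc UL₂ Umax,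
      ∀ (ω : InfVolFermionState 2) (Ls : ℕ → ℕ) (ψ : ∀ L, Fock (Orb (FermionTorus 2 L))),
      Tendsto Ls atTop atTop →
      (∀ j, IsGroundStateInSector (hubbardTorusTT' (Ls j) 1 p U') (rectN 1 (Ls j)) 0 (ψ (Ls j))) →
      (∀ j, star (ψ (Ls j)) ⬝ᵥ ψ (Ls j) = 1) → ω.IsTorusLimitOf ψ Ls →
      valL₂ U' ≤ ((Finset.univ : Finset (DihedralGroup 4)).card : ℝ)⁻¹ * ∑ g ∈ (Finset.univ : Finset (DihedralGroup 4)),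
        (ω.expect (d4ShiftSet g 0 (box 2 7)) (fermionEmbed (PolySite.d4Emb g 0 (box 2 7)) (-oddMomentObsTT p U' 0))).re)
    (hcL₂ : ∀ U' ∈ Set.Icc UL₂ Umax, -valL₂ U' ≤ ((c : ℚ) : ℝ)) :
    ∀ tp ∈ Set.Icc p q, ∀ U ∈ Set.Icc UA Umax, ObsStiffnessSeqCeilingAt tp U 1 c := by
  intro tp htp U hU
  rcases le_or_gt U UL₂ with hU2 | hU2
  · -- below the top window: the curtain master on the sub-box `[p, q] × [U_A, U_L₂]`
    exact ObsStiffnessSeqCeilingAt_halfFilling_on_box_of_curtain_orbitLower (Umax := UL₂) hUA hA1 hq valB valL₁ valO c hB hcB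
      hL₁ hcL₁ hO hcO tp htp U ⟨hU.1, hU2⟩
  · -- above `U_L₂`: follow the target's apex segment down
    have hUP : 0 < U := hUA.trans_le hU.1
    have hUne : U ≠ 0 := hUP.ne'
    by_cases hsA : p ≤ tp * (2 * U - UA) / U
    · -- (BOTTOM) the station leaf on the inner segment `[p, q]`
      have hmem : tp * (2 * U - UA) / U ∈ Set.Icc p q :=
        ⟨hsA, (apexSource_mem_Icc_of_slab (p := p) (Umax := Umax) hUA hU.1 hU.2 hq htp).2⟩
      exact ObsStiffnessSeqCeilingAt_halfFilling_of_forall_apexStation_orbitLower hUA.le valB c hB hcB hU.1 hUP hmem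
    · have hsA : tp * (2 * U - UA) / U < p := not_le.mp hsA
      -- the target is strictly left-leaning: `t′ < 0` and `p < 0`
      have ht0 : tp < 0 := by
        rcases (htp.2.trans hq).eq_or_lt with h0 | h0
        · exfalso
          rw [h0, zero_mul, zero_div] at hsA
          exact absurd (htp.1.trans_eq h0) (not_le.2 hsA)
        · exact h0
      have hp0 : p < 0 := lt_of_le_of_lt htp.1 ht0
      obtain ⟨hU'le, hapexL⟩ := leftEdge_apexSource htp.1 ht0 hUP
      have hU'gt : UA < U * (2 - p / tp) := (apexSource_lt_iff_station_lt_leftEdge ht0 hUP).1 hsA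
      -- slot `σ = p` against the target `t′` for a left-edge source (`t′_A = p`)
      have hk : 0 ≤ 2 * (p - tp) / p := div_nonneg_of_nonpos (by linarith [htp.1]) hp0.le
      have hslot : 2 * p - 2 * tp = 2 * (p - tp) / p * p := by
        rw [div_mul_cancel₀ _ hp0.ne]; ring
      by_cases h1 : U * (2 - p / tp) ≤ UL₁
      · -- (LEFT₁) source `(p, U')` in the lower window, own word, slot `p`
        have hmem : U * (2 - p / tp) ∈ Set.Icc UA UL₁ := ⟨hU'gt.le, h1⟩
        exact ObsStiffnessSeqCeilingAt_halfFilling_of_apexSource_orbitLower_slot p (U * (2 - p / tp)) (valL₁ (U * (2 - p / tp)))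
          (hUA.le.trans hU'gt.le) hU'le hUP hapexL (hL₁ _ hmem) hk hslot c (hcL₁ _ hmem)
      · have h1 : UL₁ < U * (2 - p / tp) := not_le.mp h1
        by_cases h2 : UL₂ ≤ U * (2 - p / tp)
        · -- (LEFT₂) source `(p, U')` in the upper window, own word, slot `p`
          have hmem : U * (2 - p / tp) ∈ Set.Icc UL₂ Umax := ⟨h2, hU'le.trans hU.2⟩
          exact ObsStiffnessSeqCeilingAt_halfFilling_of_apexSource_orbitLower_slot p (U * (2 - p / tp)) (valL₂ (U * (2 - p / tp)))
            (hUA.le.trans hU'gt.le) hU'le hUP hapexL (hL₂ _ hmem) hk hslot c (hcL₂ _ hmem)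
        · -- (OVERHANG at `U_L₁`) the segment passes the height `U_L₁` at `s₁ ∈ [p(2 − U_L₁/U_L₂), p)`, corner objective, slot `p`
          have h2 : U * (2 - p / tp) < UL₂ := not_le.mp h2
          have hL1pos : 0 < UL₁ := hUA.trans_le hA1
          have hL1U : UL₁ ≤ U := h12.trans hU2.le
          have hs1lt : tp * (2 * U - UL₁) / U < p := (apexSource_lt_iff_station_lt_leftEdge ht0 hUP).2 h1
          have hs1ge : p * (2 - UL₁ / UL₂) ≤ tp * (2 * U - UL₁) / U := by
            by_contra hcon
            have hlt := leftEdge_height_gt_of_apexSource_lt_shortOverhang (p := p) ht0 hL1pos h12 hU2.le (not_le.mp hcon)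
            exact absurd h2 (not_lt.2 hlt.le)
          have hmem : tp * (2 * U - UL₁) / U ∈ Set.Icc (p * (2 - UL₁ / UL₂)) p := ⟨hs1ge, hs1lt.le⟩
          have hs0 : tp * (2 * U - UL₁) / U < 0 := hs1lt.trans hp0
          have hk' : 0 ≤ 2 * (p - tp) / (tp * (2 * U - UL₁) / U) := div_nonneg_of_nonpos (by linarith [htp.1]) hs0.le
          have hslot' : 2 * p - 2 * tp = 2 * (p - tp) / (tp * (2 * U - UL₁) / U) * (tp * (2 * U - UL₁) / U) := by
            rw [div_mul_cancel₀ _ hs0.ne]; ring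
          have hapexO : U * (tp * (2 * U - UL₁) / U) = (2 * U - UL₁) * tp := by
            rw [mul_div_assoc', mul_div_cancel_left₀ _ hUne]; ring
          exact ObsStiffnessSeqCeilingAt_halfFilling_of_apexSource_orbitLower_slot p UL₁ (valO (tp * (2 * U - UL₁) / U)) hL1pos.le
            hL1U hUP hapexO (hO _ hmem) hk' hslot' c (hcO _ hmem)

end TwoWindow

/-! ## §3 EDITION (E6): ONE STATION with a SHORT corner-objective overhang + the TOP of the left edge -/

section Edition

variable {UA UL Umax p q : ℝ}

/-- **(E6) STATION + SHORT OVERHANG + LEFT-EDGE TOP.** Box `[p, q] × [U_A, U_max]`, `p ≤ q ≤ 0 < U_A ≤ U_L`. An own-word orbit-lower family `valI`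
on the INNER source segment `[p, q] × {U_A}`, an orbit-lower family `valO` for the FIXED corner objective `−X₀(p)` on the SHORT overhang
`[p(2 − U_A/U_L), p] × {U_A}` (enough for the targets below `U_L`), and an own-word orbit-lower family `valL` on the TOP of the left edge
`{p} × [U_L, U_max]`, all with `−val ≤ c`, give `ObsStiffnessSeqCeilingAt t′ U 1 c` on the whole box. Compared with (E1) the overhang shrinks from
`p(2 − U_A/U_max)` to `p(2 − U_A/U_L)`; compared with (E2)/(E3) the `U`-segment family sits at the TOP of the left edge, not at the bottom.
(The two-window master with `U_L₁ := U_A`: the lower window degenerates to the corner `(p, U_A)`, an inner source.)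
[cite: KomaTasaki1994, §1] [cite: ScalapinoWhiteZhang1993, §II] -/
theorem ObsStiffnessSeqCeilingAt_halfFilling_on_box_of_apexStation_shortOverhang_and_leftEdgeTop (hUA : 0 < UA) (hAL : UA ≤ UL)
    (hpq : p ≤ q) (hq : q ≤ 0) (valI valO valL : ℝ → ℝ) (c : ℚ)
    (hI : ∀ s ∈ Set.Icc p q,
      ∀ (ω : InfVolFermionState 2) (Ls : ℕ → ℕ) (ψ : ∀ L, Fock (Orb (FermionTorus 2 L))),
      Tendsto Ls atTop atTop →
      (∀ j, IsGroundStateInSector (hubbardTorusTT' (Ls j) 1 s UA) (rectN 1 (Ls j)) 0 (ψ (Ls j))) →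
      (∀ j, star (ψ (Ls j)) ⬝ᵥ ψ (Ls j) = 1) → ω.IsTorusLimitOf ψ Ls →
      valI s ≤ ((Finset.univ : Finset (DihedralGroup 4)).card : ℝ)⁻¹ * ∑ g ∈ (Finset.univ : Finset (DihedralGroup 4)),
        (ω.expect (d4ShiftSet g 0 (box 2 7)) (fermionEmbed (PolySite.d4Emb g 0 (box 2 7)) (-oddMomentObsTT s UA 0))).re)
    (hcI : ∀ s ∈ Set.Icc p q, -valI s ≤ ((c : ℚ) : ℝ))
    (hO : ∀ s ∈ Set.Icc (p * (2 - UA / UL)) p,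
      ∀ (ω : InfVolFermionState 2) (Ls : ℕ → ℕ) (ψ : ∀ L, Fock (Orb (FermionTorus 2 L))),
      Tendsto Ls atTop atTop →
      (∀ j, IsGroundStateInSector (hubbardTorusTT' (Ls j) 1 s UA) (rectN 1 (Ls j)) 0 (ψ (Ls j))) →
      (∀ j, star (ψ (Ls j)) ⬝ᵥ ψ (Ls j) = 1) → ω.IsTorusLimitOf ψ Ls →
      valO s ≤ ((Finset.univ : Finset (DihedralGroup 4)).card : ℝ)⁻¹ * ∑ g ∈ (Finset.univ : Finset (DihedralGroup 4)),
        (ω.expect (d4ShiftSet g 0 (box 2 7)) (fermionEmbed (PolySite.d4Emb g 0 (box 2 7)) (-oddMomentObsTT p UA 0))).re)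
    (hcO : ∀ s ∈ Set.Icc (p * (2 - UA / UL)) p, -valO s ≤ ((c : ℚ) : ℝ))
    (hL : ∀ U' ∈ Set.Icc UL Umax,
      ∀ (ω : InfVolFermionState 2) (Ls : ℕ → ℕ) (ψ : ∀ L, Fock (Orb (FermionTorus 2 L))),
      Tendsto Ls atTop atTop →
      (∀ j, IsGroundStateInSector (hubbardTorusTT' (Ls j) 1 p U') (rectN 1 (Ls j)) 0 (ψ (Ls j))) →
      (∀ j, star (ψ (Ls j)) ⬝ᵥ ψ (Ls j) = 1) → ω.IsTorusLimitOf ψ Ls →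
      valL U' ≤ ((Finset.univ : Finset (DihedralGroup 4)).card : ℝ)⁻¹ * ∑ g ∈ (Finset.univ : Finset (DihedralGroup 4)),
        (ω.expect (d4ShiftSet g 0 (box 2 7)) (fermionEmbed (PolySite.d4Emb g 0 (box 2 7)) (-oddMomentObsTT p U' 0))).re)
    (hcL : ∀ U' ∈ Set.Icc UL Umax, -valL U' ≤ ((c : ℚ) : ℝ)) :
    ∀ tp ∈ Set.Icc p q, ∀ U ∈ Set.Icc UA Umax, ObsStiffnessSeqCeilingAt tp U 1 c := by
  refine ObsStiffnessSeqCeilingAt_halfFilling_on_box_of_twoWindowCurtain_orbitLower (UL₁ := UA) (UL₂ := UL) hUA le_rfl hAL hq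
    valI (fun _ => valI p) valO valL c hI hcI (fun U' hU' => ?_) (fun U' hU' => ?_) hO hcO hL hcL
  · have hU'A : U' = UA := le_antisymm hU'.2 hU'.1
    subst hU'A
    exact hI p ⟨le_rfl, hpq⟩
  · exact hcI p ⟨le_rfl, hpq⟩

end Edition

/-! ## §4 CHORD form of (E6): three two-vertex bundles, six vertex constants -/

section Chords

variable {UA UL Umax p q : ℝ}

/-- **(E6) from THREE bundles, six vertex constants (five certificates at four points).** `p < q ≤ 0 < U_A < U_L < U_max`. INNER bundle at the station:
the chord of the own-word constants `vI₁` (at `p`) and `vI₂` (at `q`) on `[p, q] × {U_A}`; SHORT OVERHANG bundle at the station: the chord of `vO₁`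
(at `p(2 − U_A/U_L)`) and `vO₂` (at `p`) for the FIXED objective `−X₀(p)` on `[p(2 − U_A/U_L), p] × {U_A}` (the vertex `(p, U_A)` carries the objective
`−X₀(p)` in both bundles: one certificate serves `vI₁` and `vO₂`); LEFT-TOP bundle: the chord IN `U` of the own-word constants `vL₁` (at `(p, U_L)`) and
`vL₂` (at `(p, U_max)`) on `{p} × [U_L, U_max]` — what two certificates at the window's ends sharing one dual give, the `λ = 0` word being `U`-free and the
commutator constraints affine in `U`. Then `ObsStiffnessSeqCeilingAt t′ U 1 c` on the whole box for every `c ≥ max(−vI₁, −vI₂, −vO₁, −vO₂, −vL₁, −vL₂)`.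
[cite: KomaTasaki1994, §1] [cite: ScalapinoWhiteZhang1993, §II] -/
theorem ObsStiffnessSeqCeilingAt_halfFilling_on_box_of_apexStation_innerChord_shortOverhangChord_and_leftEdgeTopChord (hUA : 0 < UA)
    (hAL : UA < UL) (hLmax : UL < Umax) (hq : q ≤ 0) (hpq : p < q) (vI₁ vI₂ vO₁ vO₂ vL₁ vL₂ : ℝ) (c : ℚ)
    (hcI₁ : -vI₁ ≤ ((c : ℚ) : ℝ)) (hcI₂ : -vI₂ ≤ ((c : ℚ) : ℝ)) (hcO₁ : -vO₁ ≤ ((c : ℚ) : ℝ)) (hcO₂ : -vO₂ ≤ ((c : ℚ) : ℝ))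
    (hcL₁ : -vL₁ ≤ ((c : ℚ) : ℝ)) (hcL₂ : -vL₂ ≤ ((c : ℚ) : ℝ))
    (hI : ∀ s ∈ Set.Icc p q,
      ∀ (ω : InfVolFermionState 2) (Ls : ℕ → ℕ) (ψ : ∀ L, Fock (Orb (FermionTorus 2 L))),
      Tendsto Ls atTop atTop →
      (∀ j, IsGroundStateInSector (hubbardTorusTT' (Ls j) 1 s UA) (rectN 1 (Ls j)) 0 (ψ (Ls j))) →
      (∀ j, star (ψ (Ls j)) ⬝ᵥ ψ (Ls j) = 1) → ω.IsTorusLimitOf ψ Ls →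
      (q - s) / (q - p) * vI₁ + (s - p) / (q - p) * vI₂ ≤
        ((Finset.univ : Finset (DihedralGroup 4)).card : ℝ)⁻¹ * ∑ g ∈ (Finset.univ : Finset (DihedralGroup 4)),
          (ω.expect (d4ShiftSet g 0 (box 2 7)) (fermionEmbed (PolySite.d4Emb g 0 (box 2 7)) (-oddMomentObsTT s UA 0))).re)
    (hO : ∀ s ∈ Set.Icc (p * (2 - UA / UL)) p,
      ∀ (ω : InfVolFermionState 2) (Ls : ℕ → ℕ) (ψ : ∀ L, Fock (Orb (FermionTorus 2 L))),
      Tendsto Ls atTop atTop →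
      (∀ j, IsGroundStateInSector (hubbardTorusTT' (Ls j) 1 s UA) (rectN 1 (Ls j)) 0 (ψ (Ls j))) →
      (∀ j, star (ψ (Ls j)) ⬝ᵥ ψ (Ls j) = 1) → ω.IsTorusLimitOf ψ Ls →
      (p - s) / (p - p * (2 - UA / UL)) * vO₁ + (s - p * (2 - UA / UL)) / (p - p * (2 - UA / UL)) * vO₂ ≤
        ((Finset.univ : Finset (DihedralGroup 4)).card : ℝ)⁻¹ * ∑ g ∈ (Finset.univ : Finset (DihedralGroup 4)),
          (ω.expect (d4ShiftSet g 0 (box 2 7)) (fermionEmbed (PolySite.d4Emb g 0 (box 2 7)) (-oddMomentObsTT p UA 0))).re)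
    (hL : ∀ U' ∈ Set.Icc UL Umax,
      ∀ (ω : InfVolFermionState 2) (Ls : ℕ → ℕ) (ψ : ∀ L, Fock (Orb (FermionTorus 2 L))),
      Tendsto Ls atTop atTop →
      (∀ j, IsGroundStateInSector (hubbardTorusTT' (Ls j) 1 p U') (rectN 1 (Ls j)) 0 (ψ (Ls j))) →
      (∀ j, star (ψ (Ls j)) ⬝ᵥ ψ (Ls j) = 1) → ω.IsTorusLimitOf ψ Ls →
      (Umax - U') / (Umax - UL) * vL₁ + (U' - UL) / (Umax - UL) * vL₂ ≤
        ((Finset.univ : Finset (DihedralGroup 4)).card : ℝ)⁻¹ * ∑ g ∈ (Finset.univ : Finset (DihedralGroup 4)),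
          (ω.expect (d4ShiftSet g 0 (box 2 7)) (fermionEmbed (PolySite.d4Emb g 0 (box 2 7)) (-oddMomentObsTT p U' 0))).re) :
    ∀ tp ∈ Set.Icc p q, ∀ U ∈ Set.Icc UA Umax, ObsStiffnessSeqCeilingAt tp U 1 c := by
  have hov : p * (2 - UA / UL) < p := by
    have hp0 : p < 0 := hpq.trans_le hq
    have hL : 0 < UL := hUA.trans hAL
    have hr : UA / UL < 1 := (div_lt_one hL).2 hAL
    nlinarith
  refine ObsStiffnessSeqCeilingAt_halfFilling_on_box_of_apexStation_shortOverhang_and_leftEdgeTop hUA hAL.le hpq.le hq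
    (fun s => (q - s) / (q - p) * vI₁ + (s - p) / (q - p) * vI₂)
    (fun s => (p - s) / (p - p * (2 - UA / UL)) * vO₁ + (s - p * (2 - UA / UL)) / (p - p * (2 - UA / UL)) * vO₂)
    (fun U' => (Umax - U') / (Umax - UL) * vL₁ + (U' - UL) / (Umax - UL) * vL₂) c hI (fun s hs => ?_) hO (fun s hs => ?_) hL
    (fun U' hU' => ?_)
  · obtain ⟨hl₁, hl₂, hsum, -, -⟩ := tPrimeSegment_weights hpq hs.1 hs.2
    have hmin := min_le_chord_of_weights (c₁ := vI₁) (c₂ := vI₂) hl₁ hl₂ hsum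
    have hneg : -min vI₁ vI₂ ≤ ((c : ℚ) : ℝ) := by
      rcases le_total vI₁ vI₂ with hv | hv
      · rw [min_eq_left hv]; exact hcI₁
      · rw [min_eq_right hv]; exact hcI₂
    linarith
  · obtain ⟨hl₁, hl₂, hsum, -, -⟩ := tPrimeSegment_weights hov hs.1 hs.2
    have hmin := min_le_chord_of_weights (c₁ := vO₁) (c₂ := vO₂) hl₁ hl₂ hsum
    have hneg : -min vO₁ vO₂ ≤ ((c : ℚ) : ℝ) := by
      rcases le_total vO₁ vO₂ with hv | hv
      · rw [min_eq_left hv]; exact hcO₁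
      · rw [min_eq_right hv]; exact hcO₂
    linarith
  · obtain ⟨hl₁, hl₂, hsum, -, -⟩ := tPrimeSegment_weights hLmax hU'.1 hU'.2
    have hmin := min_le_chord_of_weights (c₁ := vL₁) (c₂ := vL₂) hl₁ hl₂ hsum
    have hneg : -min vL₁ vL₂ ≤ ((c : ℚ) : ℝ) := by
      rcases le_total vL₁ vL₂ with hv | hv
      · rw [min_eq_left hv]; exact hcL₁
      · rw [min_eq_right hv]; exact hcL₂
    linarith

end Chords

end Summit.Ventures.CertifiedManyBodySolver.Observables

end
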